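import Summits.QuantumFields.BalabanUV.Beta.EriceRemainderEnclosureHistoryAutonomyThresholdDiscrete

/-!
# EriceRemainderEnclosureHistoryAutonomyThresholdMarkov — (E46c) THE MARKOV CLASS HAS THE PER-GEOMETRY THRESHOLD `2(1+bγ²)^{3∕2}` AT EVERY
# GEOMETRY: a Markov functional `u ↦ φ(u 0)` with `φ` `L`-Lipschitz and floor `b > 0` on ]0,γ] has unique box solutions from every pin as soon
# as `L·γ³ ≤ 2(1 + bγ²)√(1 + bγ²)` — NO condition `bγ² ≥ 2` (node U2's one-step injectivity, run on the WINDOW ]0, c_1] below which the floor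
# keeps every solution value from scale 1 on, with (E38a)'s strict half-cube sensitivity); so (E46a)'s restriction `bγ² ≥ 2` is a feature
# of MEMORY: once the binding integer scale is `m ≥ 2` (`bγ² < s₁ ≈ 1.42`, `(1+2s)³ < 4(1+s)³`) the memory class's discrete bound
# `2∕max_m (m·c_m³)` is SMALLER than the Markov bound `2∕c_1³`, and whether a functional with genuine memory can be non-unique in between is
# OPEN; for `bγ² ≥ 2` the two bounds agree and are exact ((E46b))

Cell `pub-balaban`, β-function sub-cell, BINDER row D4 «RemainderConst leaves for Bałaban's split» (`HOME/BINDER-OWNERS.md`; owner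
lineage `b2b-balaban-beta-an4`; this file by co-owner #2 lineage `b2b-balaban-beta-d4-p2`, generation 41), β-FLOW TEAM duty (1),
FREEZE (0) honoured (def-free; (E46a) `…HistoryAutonomyThresholdDiscrete.inv_sqrt_cube_eq`, (E38a) `abs_sub_lt_half_cube_mul` ∕
`le_inv_sqrt_of_le_inv_sq`, node U2's `memFlow_sq_le` BY NAME; node U2's `Sharpness.memFlow_unique_of_markov` (injectivity on the whole box)
and (E37i) `memFlow_unique_of_markov_ratio` (`L·γ < 3√3·b`) are the predecessors — here the window and the geometry enter).

HONEST FRAMING (page 1, verbatim and binding).  *"Discharging BetaPertH makes Bałaban's UV stability UNCONDITIONAL — a real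
constructive-QFT result; it is NOT the continuum limit and NOT the Clay problem."*  THIS FILE DISCHARGES NOTHING OF THE KIND.  Elementary
real analysis about an ABSTRACT Markov functional; Bałaban's (1.22) is NOT Markov in the preceding couplings ([I] p. 298) and nothing of it
is asserted.  Row D4 class UNCHANGED (critical-path width 0; instance 0∕1; D4 DISCHARGE NO DATE).  HONEST DEPENDENCY: continuum YM on T⁴ ⇐
BetaPertH ∧ nine spine estimates (0/9 proved); BetaPertH ⇐ (D1) ∧ (D4) ∧ CAP+tail; G-an2-4 gates asym, D1 and NE2/3/4.

WHAT IS PROVED ([folklore]; 0 `def`, 0 sorry).  `le_window_of_memFlow` (from scale 1 on every box solution with floor `b` from a pin `≤ γ`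
lies in ]0, c_1], `c_1 = (1∕γ² + b)^{−1∕2}`), **`markov_injective_on_window`** (`L·c_1³ ≤ 2 ⟹` the one-step map `x ↦ 1∕x² − φ x` is injective
on ]0, c_1]), **`memFlow_unique_of_markov_geometry`** (`L·γ³ ≤ 2(1+bγ²)√(1+bγ²)` ⟹ unique, ANY `bγ² > 0`), `markov_ratio_threshold`
(ratio form: `L·γ∕b ≤ 2(1+bγ²)^{3∕2}∕(bγ²)` suffices — `≥ 3√3` always, (E38a)'s `cubic_absorption_27`).
-/

noncomputable section
open Filter Topology Finset

namespace Summit.QuantumFields.BalabanUV.Beta.EriceRemainderEnclosureHistoryAutonomyThresholdMarkov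

open Literature.MathematicalPhysics.QuantumFieldTheory.Balaban1983to89
open Literature.MathematicalPhysics.QuantumFieldTheory.Balaban1983to89.T4BetaStationary
open Literature.MathematicalPhysics.QuantumFieldTheory.Balaban1983to89.T4BetaFlowWellPosed
open Summit.QuantumFields.BalabanUV.Beta.EriceRemainderEnclosureHistoryAutonomyThreshold
open Summit.QuantumFields.BalabanUV.Beta.EriceRemainderEnclosureHistoryAutonomyThresholdDiscrete

variable {φ : ℝ → ℝ} {L γ b gIR : ℝ} {h h' : ℕ → ℝ}

/-- THE WINDOW: a box solution of a Markov flow with floor `b` from a pin `gIR ≤ γ` has `h(m+1) ≤ c_1 = 1∕√(1∕γ² + b)` at every scale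
`m+1 ≥ 1`. [folklore] -/
theorem le_window_of_memFlow (hb : 0 < b) (hgIR : 0 < gIR) (hgIRγ : gIR ≤ γ) (hlo : ∀ x, 0 < x → x ≤ γ → b ≤ φ x)
    (hh : SeqBox γ h) (hf : MemFlow (fun u => φ (u 0)) gIR h) (m : ℕ) :
    h (m + 1) ≤ 1 / Real.sqrt (1 / γ ^ 2 + b) := by
  have hγ : 0 < γ := lt_of_lt_of_le hgIR hgIRγ
  have hloB : ∀ u, SeqBox γ u → b ≤ (fun u : ℕ → ℝ => φ (u 0)) u := fun u hu => hlo (u 0) (hu 0).1 (hu 0).2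
  have h1 := memFlow_sq_le hloB hb hgIR hh hf (m + 1)
  have hpin : 1 / γ ^ 2 ≤ 1 / gIR ^ 2 := one_div_le_one_div_of_le (by positivity) (pow_le_pow_left₀ hgIR.le hgIRγ 2)
  have hP0 : 0 < 1 / γ ^ 2 + b := by positivity
  have h2 : 1 / γ ^ 2 + b ≤ 1 / h (m + 1) ^ 2 := by
    have h3 : 1 / gIR ^ 2 + (((m + 1 : ℕ) : ℝ)) * b ≤ 1 / h (m + 1) ^ 2 := by
      have := one_div_le_one_div_of_le (pow_pos (hh (m + 1)).1 2) h1
      rwa [one_div_one_div] at this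
    refine le_trans ?_ h3
    push_cast
    nlinarith [(Nat.cast_nonneg m : (0 : ℝ) ≤ m)]
  exact le_inv_sqrt_of_le_inv_sq (hh (m + 1)).1 hP0 h2

/-- **ONE-STEP INJECTIVITY ON THE WINDOW**: if `φ` is `L`-Lipschitz on ]0,γ] and `L·c_1³ ≤ 2`, `c_1 = 1∕√(1∕γ² + b) ≤ γ`, then
`x ↦ 1∕x² − φ x` is injective on ]0, c_1] — (E38a)'s STRICT sensitivity `|x − x′| < (c_1³∕2)·|1∕x² − 1∕x′²|` for `x ≠ x′`. [folklore] -/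
theorem markov_injective_on_window (hγ : 0 < γ) (hb : 0 < b)
    (hL : ∀ x x', 0 < x → x ≤ γ → 0 < x' → x' ≤ γ → |φ x - φ x'| ≤ L * |x - x'|)
    (hsmall : L * (1 / Real.sqrt (1 / γ ^ 2 + b)) ^ 3 ≤ 2) :
    ∀ x x', 0 < x → x ≤ 1 / Real.sqrt (1 / γ ^ 2 + b) → 0 < x' → x' ≤ 1 / Real.sqrt (1 / γ ^ 2 + b) →
      1 / x ^ 2 - φ x = 1 / x' ^ 2 - φ x' → x = x' := by
  intro x x' hx hxc hx' hx'c heq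
  set C : ℝ := 1 / Real.sqrt (1 / γ ^ 2 + b) with hC
  have hCγ : C ≤ γ := inv_sqrt_le_of_inv_sq_le hγ (le_add_of_nonneg_right hb.le)
  by_contra hne
  have hstrict := abs_sub_lt_half_cube_mul hx hx' hxc hx'c hne
  have hφ : |φ x - φ x'| ≤ L * |x - x'| := hL x x' hx (hxc.trans hCγ) hx' (hx'c.trans hCγ)
  have e : 1 / x ^ 2 - 1 / x' ^ 2 = φ x - φ x' := by linarith
  have hpos : 0 < |x - x'| := abs_pos.2 (sub_ne_zero.2 hne)
  have key : |x - x'| < |x - x'| := by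
    calc |x - x'| < C ^ 3 / 2 * |1 / x ^ 2 - 1 / x' ^ 2| := hstrict
      _ = C ^ 3 / 2 * |φ x - φ x'| := by rw [e]
      _ ≤ C ^ 3 / 2 * (L * |x - x'|) := mul_le_mul_of_nonneg_left hφ (by positivity)
      _ = (L * C ^ 3) / 2 * |x - x'| := by ring
      _ ≤ 2 / 2 * |x - x'| := mul_le_mul_of_nonneg_right (div_le_div_of_nonneg_right hsmall (by norm_num)) hpos.le
      _ = |x - x'| := by ring
  exact lt_irrefl _ key

/-- **MARKOV UNIQUENESS AT EVERY GEOMETRY**: `φ` `L`-Lipschitz with floor `b > 0` on ]0,γ], pin `gIR ∈ ]0,γ]`, and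
`L·γ³ ≤ 2(1 + bγ²)√(1 + bγ²)` (i.e. `L·c_1³ ≤ 2`) ⟹ two box solutions of the flow of `u ↦ φ(u 0)` coincide — for ANY `bγ² > 0`
(node U2's scale-by-scale induction, each step on the window ]0, c_1]).  Compare (E46a) `memFlow_unique_of_strongAF`: the same bound for
ARBITRARY memory, but only for `bγ² ≥ 2` (the discrete condition of (E46a) reaches down to `s₁ ≈ 1.42`). [folklore] -/
theorem memFlow_unique_of_markov_geometry
    (hL : ∀ x x', 0 < x → x ≤ γ → 0 < x' → x' ≤ γ → |φ x - φ x'| ≤ L * |x - x'|)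
    (hb : 0 < b) (hlo : ∀ x, 0 < x → x ≤ γ → b ≤ φ x) (hgIR : 0 < gIR) (hgIRγ : gIR ≤ γ)
    (hsmall : L * γ ^ 3 ≤ 2 * ((1 + b * γ ^ 2) * Real.sqrt (1 + b * γ ^ 2)))
    (hh : SeqBox γ h) (hh' : SeqBox γ h') (hf : MemFlow (fun u => φ (u 0)) gIR h)
    (hf' : MemFlow (fun u => φ (u 0)) gIR h') : h = h' := by
  have hγ : 0 < γ := lt_of_lt_of_le hgIR hgIRγ
  have hQ : 0 < (1 + b * γ ^ 2) * Real.sqrt (1 + b * γ ^ 2) := by positivity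
  -- `L·c_1³ ≤ 2` from the displayed smallness, through (E46a)'s `inv_sqrt_cube_eq` at `m = 1`
  have hsmall' : L * (1 / Real.sqrt (1 / γ ^ 2 + b)) ^ 3 ≤ 2 := by
    have e1 := inv_sqrt_cube_eq hγ hb 1
    rw [Nat.cast_one, one_mul, one_mul] at e1
    rw [e1, ← mul_div_assoc, div_le_iff₀ hQ]
    exact hsmall
  have hinj := markov_injective_on_window hγ hb hL hsmall'
  funext m
  induction m with
  | zero => rw [hf.1, hf'.1]
  | succ m ih =>
    have e := hf.2 m
    have e' := hf'.2 m
    simp only [add_zero] at e e'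
    rw [ih] at e
    exact hinj _ _ (hh (m + 1)).1 (le_window_of_memFlow hb hgIR hgIRγ hlo hh hf m) (hh' (m + 1)).1
      (le_window_of_memFlow hb hgIR hgIRγ hlo hh' hf' m) (by linarith)

/-- RATIO FORM: the Markov per-geometry bound in the ratio `L·γ∕b` is `2(1+bγ²)^{3∕2}∕(bγ²) ≥ 3√3` at EVERY geometry (equality iff `bγ² = 2`;
(E38a)'s `cubic_absorption_27` with `X = 1`, `t = bγ²`) — so (E37i)'s `L·γ < 3√3·b` is the corollary of `memFlow_unique_of_markov_geometry`.
[folklore] -/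
theorem markov_ratio_threshold (hγ : 0 < γ) (hb : 0 < b) (hratio : L * γ ≤ 3 * Real.sqrt 3 * b) :
    L * γ ^ 3 ≤ 2 * ((1 + b * γ ^ 2) * Real.sqrt (1 + b * γ ^ 2)) := by
  set t : ℝ := b * γ ^ 2 with ht
  have ht0 : 0 < t := by positivity
  -- `27·t² ≤ 4(1+t)³`, i.e. `3√3·t ≤ 2(1+t)√(1+t)`
  have hcub : (3 * Real.sqrt 3 * t) ^ 2 ≤ (2 * ((1 + t) * Real.sqrt (1 + t))) ^ 2 := by
    have e1 : (3 * Real.sqrt 3 * t) ^ 2 = 27 * 1 * t ^ 2 := by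
      rw [mul_pow, mul_pow, Real.sq_sqrt (by norm_num : (0 : ℝ) ≤ 3)]; ring
    have e2 : (2 * ((1 + t) * Real.sqrt (1 + t))) ^ 2 = 4 * (1 + t) ^ 3 := by
      rw [mul_pow, mul_pow, Real.sq_sqrt (by positivity)]; ring
    rw [e1, e2]; exact cubic_absorption_27 zero_le_one ht0.le
  have h1 : 3 * Real.sqrt 3 * t ≤ 2 * ((1 + t) * Real.sqrt (1 + t)) :=
    (pow_le_pow_iff_left₀ (by positivity) (by positivity) two_ne_zero).1 hcub
  calc L * γ ^ 3 = (L * γ) * γ ^ 2 := by ring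
    _ ≤ (3 * Real.sqrt 3 * b) * γ ^ 2 := mul_le_mul_of_nonneg_right hratio (by positivity)
    _ = 3 * Real.sqrt 3 * t := by rw [ht]; ring
    _ ≤ 2 * ((1 + t) * Real.sqrt (1 + t)) := h1

end Summit.QuantumFields.BalabanUV.Beta.EriceRemainderEnclosureHistoryAutonomyThresholdMarkov

end
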